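import Summits.HubbardSuperconductivity.HubbardSuperconductivity.Theorems.AnisotropyChordSpinMonotoneTwoMagnonRook

/-!
# Route `AnisotropyChord`: the two-magnon rung TM-VT on EVERY connected coordinate-symmetric graph
# on a product `α × β` (classification capstone of the complete-multipartite, edge-transitive and rook theorems)

**Theorem** (`prodSym_twoMagnon_condensate_monotone`).  Let `G` be a connected graph on `α × β`
(`|α|, |β| ≥ 2`) invariant under all independent coordinate permutations
`(a, b) ↦ (e₁ a, e₂ b)`.  Then in the two-magnon sector of `H(Δ) = xxzHamiltonian 1 G (−1) Δ`, for
all `Δ₁ ≤ Δ₂ ≤ 1` and normalised sector ground states: `Λ(ψ₁) ≤ Λ(ψ₂)`.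

Proof = classification.  By `S_α × S_β`-invariance adjacency is constant on the three pair classes
(row / column / far; `prodSym_adj_iff`), so `G` is one of `2³ = 8` graphs: the rook graph
`K ⊔ K`-free union `row ∪ col` (`rook_twoMagnon_condensate_monotone`, two contact orbits); the
complete graph and the two complete multipartite graphs `row ∪ far`, `col ∪ far` (parts = columns,
resp. rows; `completeMultipartite_condensate_monotone`, Theorem VI); the tensor product
`K_{|α|} × K_{|β|}` = `far` (vertex- and edge-transitive, `twoMagnon_condensate_monotone_of_
edgeTransitive`); and the three disconnected ones (`row`, `col`, `∅`), excluded by connectedness.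
So the whole `S_α × S_β` scheme is settled for the two-magnon rung.  No definition is introduced.
-/

set_option linter.dupNamespace false

noncomputable section

namespace Summit.HubbardSuperconductivity.HubbardSuperconductivity.Theorems.AnisotropyChord.TwoMagnon

open Matrix Complex Finset
open Literature.MathematicalPhysics.QuantumLattice
open Literature.Combinatorics.SimpleGraph (IsVertexTransitive)
open Literature.Combinatorics.SimpleGraph.LovaszThetaEdgeTransitive (IsEdgeTransitive)

variable {α β : Type*} [Fintype α] [DecidableEq α] [Fintype β] [DecidableEq β]

section ProdSym

variable {G : SimpleGraph (α × β)}

omit [Fintype α] [Fintype β] in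
/-- A coordinate-symmetric graph is vertex-transitive. [folklore] -/
theorem prodSym_isVertexTransitive
    (hinv : ∀ (e₁ : α ≃ α) (e₂ : β ≃ β) (x y : α × β),
      G.Adj (Equiv.prodCongr e₁ e₂ x) (Equiv.prodCongr e₁ e₂ y) ↔ G.Adj x y) :
    IsVertexTransitive G := by
  intro x y
  refine ⟨{ toEquiv := Equiv.prodCongr (Equiv.swap x.1 y.1) (Equiv.swap x.2 y.2),
            map_rel_iff' := fun {a b} => hinv _ _ a b }, ?_⟩
  show Equiv.prodCongr (Equiv.swap x.1 y.1) (Equiv.swap x.2 y.2) x = y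
  rw [prodCongr_apply_mk, Equiv.swap_apply_left, Equiv.swap_apply_left]

omit [Fintype α] [Fintype β] in
/-- **Adjacency of a coordinate-symmetric graph is decided by the pair class**: with reference sites
`a₀ ≠ a₁`, `b₀ ≠ b₁`, `x ∼ y` iff (`x, y` a row pair and the reference row pair is an edge) or
(column pair, reference column edge) or (far pair, reference far edge). [folklore] -/
theorem prodSym_adj_iff
    (hinv : ∀ (e₁ : α ≃ α) (e₂ : β ≃ β) (x y : α × β),
      G.Adj (Equiv.prodCongr e₁ e₂ x) (Equiv.prodCongr e₁ e₂ y) ↔ G.Adj x y)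
    {a₀ a₁ : α} (hα : a₀ ≠ a₁) {b₀ b₁ : β} (hβ : b₀ ≠ b₁) (x y : α × β) :
    G.Adj x y ↔
      (x.1 ≠ y.1 ∧ x.2 = y.2 ∧ G.Adj (a₀, b₀) (a₁, b₀)) ∨
      (x.1 = y.1 ∧ x.2 ≠ y.2 ∧ G.Adj (a₀, b₀) (a₀, b₁)) ∨
      (x.1 ≠ y.1 ∧ x.2 ≠ y.2 ∧ G.Adj (a₀, b₀) (a₁, b₁)) := by
  by_cases h1 : x.1 = y.1
  · by_cases h2 : x.2 = y.2
    · have hxy : x = y := Prod.ext h1 h2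
      subst hxy
      simp
    · -- column pair
      obtain ⟨e₂, hc, hd⟩ := exists_perm_apply_pair h2 hβ
      have hπx : Equiv.prodCongr (Equiv.swap x.1 a₀) e₂ x = (a₀, b₀) := by
        rw [prodCongr_apply_mk, Equiv.swap_apply_left, hc]
      have hπy : Equiv.prodCongr (Equiv.swap x.1 a₀) e₂ y = (a₀, b₁) := by
        rw [prodCongr_apply_mk, ← h1, Equiv.swap_apply_left, hd]
      rw [← hinv (Equiv.swap x.1 a₀) e₂ x y, hπx, hπy]
      simp [h1, h2]
  · by_cases h2 : x.2 = y.2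
    · -- row pair
      obtain ⟨e₁, ha, hb⟩ := exists_perm_apply_pair h1 hα
      have hπx : Equiv.prodCongr e₁ (Equiv.swap x.2 b₀) x = (a₀, b₀) := by
        rw [prodCongr_apply_mk, ha, Equiv.swap_apply_left]
      have hπy : Equiv.prodCongr e₁ (Equiv.swap x.2 b₀) y = (a₁, b₀) := by
        rw [prodCongr_apply_mk, hb, ← h2, Equiv.swap_apply_left]
      rw [← hinv e₁ (Equiv.swap x.2 b₀) x y, hπx, hπy]
      simp [h1, h2]
    · -- far pair
      obtain ⟨e₁, ha, hb⟩ := exists_perm_apply_pair h1 hα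
      obtain ⟨e₂, hc, hd⟩ := exists_perm_apply_pair h2 hβ
      have hπx : Equiv.prodCongr e₁ e₂ x = (a₀, b₀) := by rw [prodCongr_apply_mk, ha, hc]
      have hπy : Equiv.prodCongr e₁ e₂ y = (a₁, b₁) := by rw [prodCongr_apply_mk, hb, hd]
      rw [← hinv e₁ e₂ x y, hπx, hπy]
      simp [h1, h2]

omit [Fintype α] [DecidableEq α] [Fintype β] [DecidableEq β] in
/-- If every edge preserves the second coordinate, so does reachability. [folklore] -/
theorem snd_eq_of_reachable (h : ∀ x y : α × β, G.Adj x y → x.2 = y.2) {x y : α × β}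
    (hr : G.Reachable x y) : x.2 = y.2 := by
  obtain ⟨w⟩ := hr
  induction w with
  | nil => rfl
  | cons hadj _ ih => exact (h _ _ hadj).trans ih

omit [Fintype α] [DecidableEq α] [Fintype β] [DecidableEq β] in
/-- If every edge preserves the first coordinate, so does reachability. [folklore] -/
theorem fst_eq_of_reachable (h : ∀ x y : α × β, G.Adj x y → x.1 = y.1) {x y : α × β}
    (hr : G.Reachable x y) : x.1 = y.1 := by
  obtain ⟨w⟩ := hr
  induction w with
  | nil => rfl
  | cons hadj _ ih => exact (h _ _ hadj).trans ih

end ProdSym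

/-- **TM-VT on every connected coordinate-symmetric graph on `α × β`** (`|α|, |β| ≥ 2`; see the
module docstring for the classification): two-magnon sector, all `Δ₁ ≤ Δ₂ ≤ 1`, normalised sector
ground states ⇒ `Λ(ψ₁) ≤ Λ(ψ₂)`. [folklore] -/
theorem prodSym_twoMagnon_condensate_monotone (G : SimpleGraph (α × β)) [DecidableRel G.Adj]
    (hinv : ∀ (e₁ : α ≃ α) (e₂ : β ≃ β) (x y : α × β),
      G.Adj (Equiv.prodCongr e₁ e₂ x) (Equiv.prodCongr e₁ e₂ y) ↔ G.Adj x y)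
    (hG : G.Connected) (hα : 1 < Fintype.card α) (hβ : 1 < Fintype.card β)
    {Δ₁ Δ₂ : ℝ} (h12 : Δ₁ ≤ Δ₂) (h2 : Δ₂ ≤ 1) {ψ₁ ψ₂ : (α × β → Fin 2) → ℂ}
    (g₁m : ψ₁ ∈ spinZSector (Λ := α × β) 1 ((Fintype.card (α × β) : ℝ) / 2 - 2))
    (g₁n : star ψ₁ ⬝ᵥ ψ₁ = 1)
    (g₁e : xxzHamiltonian 1 G (-1) Δ₁ *ᵥ ψ₁ =
      ((lowestEnergyInSector 1 (xxzHamiltonian 1 G (-1) Δ₁) ((Fintype.card (α × β) : ℝ) / 2 - 2) : ℝ) : ℂ) • ψ₁)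
    (g₂m : ψ₂ ∈ spinZSector (Λ := α × β) 1 ((Fintype.card (α × β) : ℝ) / 2 - 2))
    (g₂n : star ψ₂ ⬝ᵥ ψ₂ = 1)
    (g₂e : xxzHamiltonian 1 G (-1) Δ₂ *ᵥ ψ₂ =
      ((lowestEnergyInSector 1 (xxzHamiltonian 1 G (-1) Δ₂) ((Fintype.card (α × β) : ℝ) / 2 - 2) : ℝ) : ℂ) • ψ₂) :
    (star ψ₁ ⬝ᵥ (((∑ x, onSite x (spinRaise 1)) * (∑ y, onSite y (spinLower 1)) : Op (α × β) 2) *ᵥ ψ₁)).re ≤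
      (star ψ₂ ⬝ᵥ (((∑ x, onSite x (spinRaise 1)) * (∑ y, onSite y (spinLower 1)) : Op (α × β) 2) *ᵥ ψ₂)).re := by
  obtain ⟨a₀, a₁, hα'⟩ := Fintype.one_lt_card_iff.mp hα
  obtain ⟨b₀, b₁, hβ'⟩ := Fintype.one_lt_card_iff.mp hβ
  have hVT : IsVertexTransitive G := prodSym_isVertexTransitive hinv
  have hadj := prodSym_adj_iff hinv hα' hβ'
  by_cases hr : G.Adj (a₀, b₀) (a₁, b₀) <;> by_cases hc : G.Adj (a₀, b₀) (a₀, b₁) <;>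
    by_cases hf : G.Adj (a₀, b₀) (a₁, b₁)
  · -- row ∪ col ∪ far = the complete graph (complete multipartite with singleton parts)
    have h' : ∀ x y, G.Adj x y ↔ x ≠ y := by
      intro x y
      rw [hadj]
      simp only [hr, hc, hf, and_true]
      constructor
      · rintro (⟨h1, -⟩ | ⟨-, h2⟩ | ⟨h1, -⟩) hxy
        · exact h1 (by rw [hxy])
        · exact h2 (by rw [hxy])
        · exact h1 (by rw [hxy])
      · intro hxy
        by_cases h1 : x.1 = y.1
        · have h2 : x.2 ≠ y.2 := fun h2 => hxy (Prod.ext h1 h2)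
          exact Or.inr (Or.inl ⟨h1, h2⟩)
        · by_cases h2 : x.2 = y.2
          · exact Or.inl ⟨h1, h2⟩
          · exact Or.inr (Or.inr ⟨h1, h2⟩)
    have hcm : G.IsCompleteMultipartite := by
      refine ⟨fun x y z hxy hyz => ?_⟩
      rw [h'] at hxy hyz ⊢
      push Not at hxy hyz ⊢
      exact hxy.trans hyz
    exact completeMultipartite_condensate_monotone G hG hcm h12 h2 g₁m g₁n g₁e g₂m g₂n g₂e
  · -- row ∪ col = the ROOK graph
    refine rook_twoMagnon_condensate_monotone G (fun x y => ?_) hα hβ h12 h2 g₁m g₁n g₁e g₂m g₂n g₂e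
    rw [hadj]
    simp only [hr, hc, hf, and_true, and_false, or_false]
  · -- row ∪ far: complete multipartite, parts = the columns `{a} × β`... i.e. `x ∼ y ↔ x.1 ≠ y.1`
    have h' : ∀ x y, G.Adj x y ↔ x.1 ≠ y.1 := by
      intro x y
      rw [hadj]
      simp only [hr, hc, hf, and_true, and_false, false_or]
      tauto
    have hcm : G.IsCompleteMultipartite := by
      refine ⟨fun x y z hxy hyz => ?_⟩
      rw [h'] at hxy hyz ⊢
      push Not at hxy hyz ⊢
      exact hxy.trans hyz
    exact completeMultipartite_condensate_monotone G hG hcm h12 h2 g₁m g₁n g₁e g₂m g₂n g₂e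
  · -- row only: disconnected
    exfalso
    have h' : ∀ x y, G.Adj x y → x.2 = y.2 := by
      intro x y hxy
      rw [hadj] at hxy
      simp only [hr, hc, hf, and_true, and_false, or_false] at hxy
      exact hxy.2
    exact hβ' (snd_eq_of_reachable h' (hG.preconnected (a₀, b₀) (a₀, b₁)))
  · -- col ∪ far: complete multipartite, `x ∼ y ↔ x.2 ≠ y.2`
    have h' : ∀ x y, G.Adj x y ↔ x.2 ≠ y.2 := by
      intro x y
      rw [hadj]
      simp only [hr, hc, hf, and_true, and_false, false_or]
      tauto
    have hcm : G.IsCompleteMultipartite := by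
      refine ⟨fun x y z hxy hyz => ?_⟩
      rw [h'] at hxy hyz ⊢
      push Not at hxy hyz ⊢
      exact hxy.trans hyz
    exact completeMultipartite_condensate_monotone G hG hcm h12 h2 g₁m g₁n g₁e g₂m g₂n g₂e
  · -- col only: disconnected
    exfalso
    have h' : ∀ x y, G.Adj x y → x.1 = y.1 := by
      intro x y hxy
      rw [hadj] at hxy
      simp only [hr, hc, hf, and_true, and_false, or_false, false_or] at hxy
      exact hxy.1
    exact hα' (fst_eq_of_reachable h' (hG.preconnected (a₀, b₀) (a₁, b₀)))
  · -- far only: the tensor product `K × K`, vertex- and EDGE-transitive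
    have h' : ∀ x y, G.Adj x y ↔ x.1 ≠ y.1 ∧ x.2 ≠ y.2 := by
      intro x y
      rw [hadj]
      simp only [hr, hc, hf, and_true, and_false, false_or]
    have hET : IsEdgeTransitive G := by
      intro a b c d hab hcd
      rw [h'] at hab hcd
      obtain ⟨e₁, ha, hb⟩ := exists_perm_apply_pair hab.1 hcd.1
      obtain ⟨e₂, hc', hd⟩ := exists_perm_apply_pair hab.2 hcd.2
      refine ⟨{ toEquiv := Equiv.prodCongr e₁ e₂, map_rel_iff' := fun {x y} => hinv e₁ e₂ x y },
        Or.inl ⟨?_, ?_⟩⟩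
      · show Equiv.prodCongr e₁ e₂ a = c
        rw [prodCongr_apply_mk, ha, hc']
      · show Equiv.prodCongr e₁ e₂ b = d
        rw [prodCongr_apply_mk, hb, hd]
    exact twoMagnon_condensate_monotone_of_edgeTransitive G hG hVT hET h12 h2 g₁m g₁n g₁e g₂m g₂n g₂e
  · -- no edges: disconnected
    exfalso
    have h' : ∀ x y, G.Adj x y → x.1 = y.1 := by
      intro x y hxy
      rw [hadj] at hxy
      simp only [hr, hc, hf, and_false, or_false] at hxy
    exact hα' (fst_eq_of_reachable h' (hG.preconnected (a₀, b₀) (a₁, b₀)))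

end Summit.HubbardSuperconductivity.HubbardSuperconductivity.Theorems.AnisotropyChord.TwoMagnon
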